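import Summits.QuantumFields.YangMills.Theorems.BalabanUVNodesN15KingModelFreeKernelThermodynamicLimit
import HarnessLib

/-!
# BalabanUVNodes ∕ N15 — THE KING-MODEL RUNG (PART Ε-j): THE ℓ¹-NORM AND THE EXPONENTIAL MOMENTS OF THE FREE KERNEL —
# `Σ_{z∈ℤ^{d+1}} |K_∞(z)| = 1∕m²` exactly, and `Σ_z K_∞(z)·e^{b|z|_∞} ≤ (2∕m²)·periodConst(κ_F − b) d < ∞` for every `b < κ_F`
# (Track A, DAG node N15 = NE2; FAN-OUT v1.1 §N15 s3 «KING-MODEL RUNG»; elementary corollaries of parts Ε-a∕b∕f; count-neutral)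

HONEST FRAMING.  Count-neutral (cell `pub-ymgap`, seat `pub-ymgap-dag-n15-e` g40; `--supports stmt-QuantumFields-27366 --as helper` = K3⁸).
TEMPLATE LITERATURE: C. King, Commun. Math. Phys. **102** (1986) 649–677 [King1986], (4.4) p.670, §4 p.670 l.8–13; [Balaban1983RegularityDecay] (2.43) p.584, p.586 l.9–15 (the
contour shift: exponential decay of the free propagator).  Part Ε-a: `|K_∞(z)| ≤ (2∕m²)e^{−κ_F|z|_∞}`; part Ε-b: `Σ_z K_∞(z) = 1∕m²`; part Ε-f: `K_∞ ≥ 0`.  Hence: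
§1 ★★ **`tsum_abs_freeKer`** — `Σ_z |K_∞(z)| = 1∕m²`: the `ℓ¹(ℤ^{d+1})` operator norm of convolution by `K_∞` (the free covariance as an operator on bounded functions) is EXACTLY
`1∕m²` (= the inverse spectral gap); `abs_freeKer_le_inv_mass` (`|K_∞(z)| ≤ 1∕m²` pointwise).  §2 ★★ **`summable_freeKer_expWeight`** — for `b < κ_F` the exponentially
weighted kernel `z ↦ K_∞(z)·e^{b|z|_∞}` is summable, with ★★ **`tsum_freeKer_expWeight_le`**: `Σ_z K_∞(z)e^{b|z|_∞} ≤ (2∕m²)·periodConst(κ_F − b) d` (pv17's periodisation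
constant at the residual rate, via `B4Reflection242.periodise_majorant` at the one-point torus) — exponential moments of the free covariance, the input of Paley–Wiener-type
analyticity of its lattice Fourier transform in the tube `|Im p| < κ_F` (cf. part Ϸ's `…PaleyWienerLine` for the block field).

PRIOR TREE ART (used, not restated): parts Ε-a (`abs_freeKer_le`, `summable_freeKer`), Ε-b (`tsum_freeKer_eq_inv_mass`), Ε-f (`freeKer_nonneg`), pv17 `B4TorusKernel` (`supNorm`,
`periodConst`, `translate`), `B4Reflection242.periodise_majorant`.  NOT Bałaban's covariant objects; NOT a node discharge (N15 is booked through n15-a's knit, untouched); nothing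
continuum-YM ∕ `ℝ⁴` ∕ OS ∕ Clay.  0 `sorry`, 0 `def`.

HONEST SCOPE.  `c ≥ 0`, `m² > 0`, any `d`; `b < κ_F` (the crude half-width of Ε-a, not the true mass).  Locators: [King1986] (4.4) p.670; [Balaban1983RegularityDecay] (2.43) p.584,
p.586 l.9–15.
-/

noncomputable section

open scoped BigOperators
open Finset

namespace Summit.QuantumFields.YangMills.BalabanUVNodes.N15KingModelRung.TorusSpectral

open Literature.MathematicalPhysics.QuantumFieldTheory.Balaban1983to89.B4ContourShift (supNorm supNorm_nonneg)
open Literature.MathematicalPhysics.QuantumFieldTheory.Balaban1983to89.B4TorusKernel (periodConst)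
open Literature.MathematicalPhysics.QuantumFieldTheory.Balaban1983to89.B4TorusKernel.MultiPeriod (translate)
open Literature.MathematicalPhysics.QuantumFieldTheory.Balaban1983to89.B4Reflection242 (periodise_majorant)

variable {d : ℕ} {c m2 : ℝ}

/-! ## §1 The `ℓ¹` norm of the free kernel -/

/-- ★★ **THE ℓ¹ NORM**: `Σ_{z∈ℤ^{d+1}} |K_∞(z)| = 1∕m²` (`K_∞ ≥ 0` and `Σ K_∞ = 1∕m²`) — the free covariance, as the convolution operator on `ℓ^∞(ℤ^{d+1})` (or `ℓ¹`), has norm exactly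
the inverse gap `1∕m²`. [cite: King1986, (4.4) p.670; Balaban1983RegularityDecay, (2.43) p.584] -/
theorem tsum_abs_freeKer (hc : 0 ≤ c) (hm : 0 < m2) : ∑' z : Fin (d + 1) → ℤ, |freeKer c m2 z| = m2⁻¹ := by
  rw [← tsum_freeKer_eq_inv_mass (d := d) hc hm]
  exact tsum_congr fun z => abs_of_nonneg (freeKer_nonneg hc hm z)

/-- `|K_∞|` is summable. [folklore] -/
theorem summable_abs_freeKer (hc : 0 ≤ c) (hm : 0 < m2) : Summable fun z : Fin (d + 1) → ℤ => |freeKer c m2 z| :=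
  (summable_freeKer hc hm).abs

/-- pointwise: `|K_∞(z)| ≤ 1∕m²` (a single term of the `ℓ¹` sum). [cite: King1986, (4.4) p.670] -/
theorem abs_freeKer_le_inv_mass (hc : 0 ≤ c) (hm : 0 < m2) (z : Fin (d + 1) → ℤ) : |freeKer c m2 z| ≤ m2⁻¹ := by
  rw [← tsum_abs_freeKer (d := d) hc hm]
  exact (summable_abs_freeKer hc hm).le_tsum z fun w _ => abs_nonneg _

/-! ## §2 Exponential moments -/

/-- the weighted bound: `|K_∞(z)|·e^{b|z|_∞} ≤ (2∕m²)·e^{−(κ_F − b)|z|_∞}`. [cite: Balaban1983RegularityDecay, p.586 l.9–15] -/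
theorem abs_freeKer_mul_expWeight_le (hc : 0 ≤ c) (hm : 0 < m2) (b : ℝ) (z : Fin (d + 1) → ℤ) :
    |freeKer c m2 z| * Real.exp (b * supNorm z) ≤ 2 / m2 * Real.exp (-((kappaFree c m2 d - b) * supNorm z)) := by
  have h := abs_freeKer_le (d := d) hc hm z
  calc |freeKer c m2 z| * Real.exp (b * supNorm z)
      ≤ 2 / m2 * Real.exp (-(kappaFree c m2 d * supNorm z)) * Real.exp (b * supNorm z) := mul_le_mul_of_nonneg_right h (Real.exp_pos _).le
    _ = 2 / m2 * Real.exp (-((kappaFree c m2 d - b) * supNorm z)) := by rw [mul_assoc, ← Real.exp_add]; ring_nf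

/-- ★★ **EXPONENTIAL MOMENTS ARE FINITE**: for every `b < κ_F` the weighted kernel `z ↦ K_∞(z)·e^{b|z|_∞}` is summable over ℤ^{d+1}. [cite: Balaban1983RegularityDecay, (2.43) p.584, p.586 l.9–15] -/
theorem summable_freeKer_expWeight (hc : 0 ≤ c) (hm : 0 < m2) {b : ℝ} (hb : b < kappaFree c m2 d) :
    Summable fun z : Fin (d + 1) → ℤ => freeKer c m2 z * Real.exp (b * supNorm z) := by
  have hκ : 0 < kappaFree c m2 d - b := sub_pos.mpr hb
  -- the majorant `(2∕m²)e^{−(κ_F−b)|z|_∞}` is summable (pv17's periodisation majorant at the one-point torus)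
  obtain ⟨hmaj, _⟩ := periodise_majorant (κ := kappaFree c m2 d - b) (M := 2 / m2) hκ (by positivity)
    (P := fun _ : Fin (d + 1) => 1) (fun _ => le_rfl) (0 : Fin (d + 1) → ℤ)
  have hT : ∀ m : Fin (d + 1) → ℤ, translate (fun _ : Fin (d + 1) => 1) 0 m = m := fun m => by funext i; simp
  simp_rw [hT] at hmaj
  refine Summable.of_norm_bounded hmaj fun z => ?_
  rw [Real.norm_eq_abs, abs_mul, Real.abs_exp]
  exact abs_freeKer_mul_expWeight_le hc hm b z

/-- ★★ **THE EXPONENTIAL-MOMENT BOUND**: `Σ_z K_∞(z)·e^{b|z|_∞} ≤ (2∕m²)·periodConst(κ_F − b) d` for every `b < κ_F`. [cite: Balaban1983RegularityDecay, (2.43) p.584, p.586 l.9–15] -/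
theorem tsum_freeKer_expWeight_le (hc : 0 ≤ c) (hm : 0 < m2) {b : ℝ} (hb : b < kappaFree c m2 d) :
    ∑' z : Fin (d + 1) → ℤ, freeKer c m2 z * Real.exp (b * supNorm z) ≤ 2 / m2 * periodConst (kappaFree c m2 d - b) d := by
  have hκ : 0 < kappaFree c m2 d - b := sub_pos.mpr hb
  obtain ⟨hmaj, hle⟩ := periodise_majorant (κ := kappaFree c m2 d - b) (M := 2 / m2) hκ (by positivity)
    (P := fun _ : Fin (d + 1) => 1) (fun _ => le_rfl) (0 : Fin (d + 1) → ℤ)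
  have hT : ∀ m : Fin (d + 1) → ℤ, translate (fun _ : Fin (d + 1) => 1) 0 m = m := fun m => by funext i; simp
  simp_rw [hT] at hmaj hle
  have h0 : Literature.MathematicalPhysics.QuantumFieldTheory.Balaban1983to89.B4TorusKernel.MultiPeriod.torusSupNorm (fun _ : Fin (d + 1) => 1) 0 = 0 := by
    unfold Literature.MathematicalPhysics.QuantumFieldTheory.Balaban1983to89.B4TorusKernel.MultiPeriod.torusSupNorm
    simp [Literature.MathematicalPhysics.QuantumFieldTheory.Balaban1983to89.B4TorusKernel.MultiPeriod.circAbs]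
  rw [h0, mul_zero, neg_zero, Real.exp_zero, mul_one] at hle
  refine le_trans (Summable.tsum_le_tsum (fun z => ?_) (summable_freeKer_expWeight hc hm hb) hmaj) hle
  exact le_trans (le_abs_self _) (by rw [abs_mul, Real.abs_exp]; exact abs_freeKer_mul_expWeight_le hc hm b z)

end Summit.QuantumFields.YangMills.BalabanUVNodes.N15KingModelRung.TorusSpectral

end
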